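import Summits.FinalStateConjecture.FinalStateConjecture.Theorems.EIHFluxBalanceInertialRecessionStubChargeModelBridge
import Summits.FinalStateConjecture.FinalStateConjecture.Theorems.EIHFluxBalanceInertialRecessionStubChargeModelUnpack
import Summits.FinalStateConjecture.FinalStateConjecture.Theorems.EIHFluxBalanceInertialRecessionStubChargeModelBackground
import Summits.FinalStateConjecture.FinalStateConjecture.Theorems.EIHFluxBalanceInertialRecessionAnsatzDecay
import Summits.FinalStateConjecture.FinalStateConjecture.Theorems.EIHFluxBalanceInertialRecessionStubQuasiStationarityDecay

/-!
# Route EIHFluxBalance — `InertialRecession`, line `sublinear-is-free-clean-window-charges`: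
# the lab metric on far cone points (sphere conditions of the window law; helpers for `stub_chargeModel`)

Helper file (`--supports stmt-FinalStateConjecture-10166`) for the crux
`Summit.FinalStateConjecture.FinalStateConjecture.Theses.EIHFluxBalance.InertialRecession`.

The moving-sphere law (`stub_windowCharges`, WCH′) is applied by `stub_chargeModel` to the lab metric
`lab = G + deviationExtend B Φ` of the crux's lab chart on an open set `W` where it is smooth, symmetric and
Ricci flat, along spheres on which `‖lab − η‖ ≤ 1/2` and `‖D lab‖ ≤ b`. This file supplies both:

* `labRegion_props` — `W = {x ∈ U | ‖lab x − η‖ < 1}` is open, and on it the lab metric is `C^∞`,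
  symmetric and has `MetricCoord.ricAt lab = 0` (the Ricci bridge of `…StubChargeModelBridge`);
* `sphereConditions` — **uniform far-field control**: for every threshold `ρq → ∞` there are `T` and
  `K ≥ 0` such that at every lab time `s ≥ T`, every point `y` of the cone `‖y‖ ≤ κs` at lab distance
  `d = ⨅ᵢ ‖y − ξᵢ(s)‖ ≥ ρq(s)` from the painted centres satisfies: `(s, y) ∈ W`,
  `‖lab(s, y) − η‖ ≤ 1/2`, and `‖D lab(s, y) v‖ ≤ K d^{−7/4} ‖v‖`. Ingredients: the crux's weighted `C³`
  clause (deviation and its derivative `≤ ¼(1 + d^{7/4})⁻¹`, `weightedClause_pointwise`), the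
  quasi-stationarity clause of the line for the lab-time derivative of `G` (`quasiStationarity_pointwise`),
  the `O(M/d)` size of the modulated Kerr–Schild summands (`exists_norm_iteratedFDeriv_ansatzSummand_le`,
  order `0`, which needs only `‖Λᵢ⁻¹‖ ≤ 1 + 3γ`) and the `O(M/d²)` bound on their SPATIAL derivatives
  (`norm_fderiv_modulatedBackground_spatial_le`, no rates of the moduli), assembled by
  `norm_fderiv_add_apply_le`; smoothness of the inverse frame paths is
  `SublinearIsFree.QuasiStationarity.contDiff_lorentz_symm`.
-/

set_option linter.dupNamespace false
-- instance search on the nested operator spaces needs a deeper pending depth (as in `CoordCurvature.lean`)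
set_option maxSynthPendingDepth 3

noncomputable section

open scoped Manifold ContDiff Topology BigOperators ENNReal
open Filter Set Function TopologicalSpace Literature.Geometry.Lorentzian

namespace Summit.FinalStateConjecture.FinalStateConjecture.Theorems

namespace ChargeModel

/-! ### The region where the lab metric is near `η` -/

/-- **The region `W = {x ∈ U | ‖lab x − η‖ < 1}` of a lab chart**: it is open, and on it the lab metric
`lab = G + deviationExtend B Φ` is `C^∞`, symmetric, and — the spacetime being vacuum — has vanishing
coordinate Ricci form (`labMetric_ricAt_eq_zero_of_norm_sub_lt`). [cite: ONeill1983, Ch. 3, Prop. 3.59 and Lemma 3.52] -/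
theorem labRegion_props (𝓢 : Spacetime 4) (B : ModelBackground) (Φ : B.domain → 𝓢.carrier)
    (hΦ : ContMDiff 𝓘(ℝ, E4) (𝓡 4) ∞ Φ)
    (hRic : ∀ [𝓢.metric.toPseudoRiemannianMetric.HasLeviCivita],
      𝓢.metric.toPseudoRiemannianMetric.IsRicciFlat) :
    IsOpen {x : E4 | x ∈ (B.domain : Set E4) ∧ ‖(B.bilin x + 𝓢.deviationExtend B Φ x) - Minkowski.bilin‖ < 1} ∧
    ContDiffOn ℝ ∞ (fun x ↦ B.bilin x + 𝓢.deviationExtend B Φ x)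
      {x : E4 | x ∈ (B.domain : Set E4) ∧ ‖(B.bilin x + 𝓢.deviationExtend B Φ x) - Minkowski.bilin‖ < 1} ∧
    (∀ x ∈ {x : E4 | x ∈ (B.domain : Set E4) ∧ ‖(B.bilin x + 𝓢.deviationExtend B Φ x) - Minkowski.bilin‖ < 1},
      ∀ v w : E4, (B.bilin x + 𝓢.deviationExtend B Φ x) v w = (B.bilin x + 𝓢.deviationExtend B Φ x) w v) ∧
    (∀ x ∈ {x : E4 | x ∈ (B.domain : Set E4) ∧ ‖(B.bilin x + 𝓢.deviationExtend B Φ x) - Minkowski.bilin‖ < 1},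
      MetricCoord.ricAt (fun y ↦ B.bilin y + 𝓢.deviationExtend B Φ y) x = 0) := by
  have hcont := LabMetric.continuousOn_bilin_add_deviationExtend 𝓢 B hΦ
  have hO : IsOpen ((B.domain : Set E4) ∩
      (fun y ↦ B.bilin y + 𝓢.deviationExtend B Φ y) ⁻¹' Metric.ball Minkowski.bilin 1) :=
    hcont.isOpen_inter_preimage B.domain.2 Metric.isOpen_ball
  have hset : {x : E4 | x ∈ (B.domain : Set E4) ∧
      ‖(B.bilin x + 𝓢.deviationExtend B Φ x) - Minkowski.bilin‖ < 1} =
      (B.domain : Set E4) ∩ (fun y ↦ B.bilin y + 𝓢.deviationExtend B Φ y) ⁻¹' Metric.ball Minkowski.bilin 1 := by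
    ext x
    simp only [mem_setOf_eq, mem_inter_iff, mem_preimage]
    rw [mem_ball_iff_norm (a := Minkowski.bilin) (b := B.bilin x + 𝓢.deviationExtend B Φ x) (r := 1)]
  refine ⟨by rw [hset]; exact hO, ?_, ?_, ?_⟩
  · exact (LabMetric.contDiffOn_bilin_add_deviationExtend 𝓢 B hΦ).mono fun x hx ↦ hx.1
  · intro x hx v w
    exact LabMetric.bilin_add_deviationExtend_symm 𝓢 B Φ ⟨x, hx.1⟩ v w
  · intro x hx
    exact LabMetric.ricAt_bilin_add_deviationExtend_eq_zero_of_norm_sub_lt 𝓢 B hΦ hRic hx.1 hx.2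


/-! ### Uniform far-field control of the lab metric -/

-- the algebraic and the operator-norm instance paths on `E4 →L[ℝ] E4 →L[ℝ] ℝ` unify slowly
set_option synthInstance.maxHeartbeats 400000 in
set_option maxHeartbeats 3200000 in
/-- **Sphere conditions of the window law, uniformly on far cone points.** For the crux's lab chart
(vacuum spacetime, smooth chart map `Φ`, modulated multi-Kerr–Schild background with Lorentz factors
`≤ γ` and smooth moduli, domain clause, weighted `C³` decay clause) and the quasi-stationarity clause of
the line, and for every threshold `ρq → ∞`: there are `T` and `K ≥ 0` such that at every lab time
`s ≥ T` every cone point `y`, `‖y‖ ≤ κ s`, at distance `d = ⨅ᵢ ‖y − ξᵢ(s)‖ ≥ ρq(s)` from the centres has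
`(s, y) ∈ U` with `‖lab(s,y) − η‖ < 1` (so it lies in the region of `labRegion_props`),
`‖lab(s,y) − η‖ ≤ 1/2`, and `‖D lab(s,y) v‖ ≤ K d^{-7/4} ‖v‖` for all `v`. [folklore] -/
theorem sphereConditions (𝓢 : Spacetime 4) {N : ℕ} (M a rin : Fin N → ℝ) (Λ : Fin N → ℝ → lorentzGroup)
    (ξ : Fin N → ℝ → E3) (γ κ τ₀ : ℝ) (U : Opens E4) (Φ : U → 𝓢.carrier)
    (hrin : ∀ i, 0 ≤ rin i)
    (hγ : ∀ i t, |((Λ i t : E4 ≃L[ℝ] E4) (E4.basisVector 0)) 0| ≤ γ)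
    (hΛ : ∀ i, ContDiff ℝ ∞ (fun t ↦ ((Λ i t : E4 ≃L[ℝ] E4) : E4 →L[ℝ] E4)))
    (hξ : ∀ i, ContDiff ℝ ∞ (ξ i))
    (hU : {x : E4 | τ₀ < x 0 ∧ ∀ i, rin i < Kerr.radius (a i)
      (poincareInv (Λ i (x 0)) (E4.ofTimeSpace (x 0) (ξ i (x 0))) x)} ⊆ (U : Set E4))
    (hΦ : ContMDiff 𝓘(ℝ, E4) (𝓡 4) ∞ Φ)
    (hWt : Tendsto (fun t : ℝ ↦ ⨆ x ∈ {x : U | x.1 0 = t ∧ E4.spatialNorm x.1 ≤ κ * t},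
      ⨆ (m : ℕ) (_ : m ≤ 3), ENNReal.ofReal (1 + √(√((⨅ i, ‖E4.spatial x.1 - ξ i t‖) ^ 7))) *
        ‖iteratedFDeriv ℝ m (𝓢.deviationExtend (⟨U, fun x ↦ Minkowski.bilin + ∑ i, (boostedKerrBilin (Λ i (x 0)) (E4.ofTimeSpace (x 0) (ξ i (x 0))) (M i) (a i) x - Minkowski.bilin), fun x ↦ x 0, E4.spatialNorm⟩ : ModelBackground) Φ) x.1‖ₑ) atTop (𝓝 0))
    (hQ : ∀ ρ : ℝ → ℝ, Tendsto ρ atTop atTop → Tendsto (fun t : ℝ ↦ ⨆ x ∈ {x : E4 | x 0 = t ∧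
      E4.spatialNorm x ≤ κ * t ∧ ρ t ≤ ⨅ i, ‖E4.spatial x - ξ i t‖},
        ENNReal.ofReal (1 + √(√((⨅ i, ‖E4.spatial x - ξ i t‖) ^ 7))) *
          ‖fderiv ℝ (fun y : E4 ↦ Minkowski.bilin + ∑ i, (boostedKerrBilin (Λ i (y 0)) (E4.ofTimeSpace (y 0) (ξ i (y 0))) (M i) (a i) y - Minkowski.bilin)) x (E4.basisVector 0)‖ₑ) atTop (𝓝 0))
    (ρq : ℝ → ℝ) (hρq : Tendsto ρq atTop atTop) :
    ∃ T K : ℝ, 0 ≤ K ∧ ∀ (s : ℝ) (y : E3), T ≤ s → ‖y‖ ≤ κ * s → ρq s ≤ ⨅ i, ‖y - ξ i s‖ →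
      (E4.ofTimeSpace s y ∈ (U : Set E4) ∧
        ‖(fun x : E4 ↦ (Minkowski.bilin + ∑ i, (boostedKerrBilin (Λ i (x 0)) (E4.ofTimeSpace (x 0) (ξ i (x 0))) (M i) (a i) x - Minkowski.bilin)) + 𝓢.deviationExtend (⟨U, fun x ↦ Minkowski.bilin + ∑ i, (boostedKerrBilin (Λ i (x 0)) (E4.ofTimeSpace (x 0) (ξ i (x 0))) (M i) (a i) x - Minkowski.bilin), fun x ↦ x 0, E4.spatialNorm⟩ : ModelBackground) Φ x) (E4.ofTimeSpace s y) - Minkowski.bilin‖ < 1) ∧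
      ‖(fun x : E4 ↦ (Minkowski.bilin + ∑ i, (boostedKerrBilin (Λ i (x 0)) (E4.ofTimeSpace (x 0) (ξ i (x 0))) (M i) (a i) x - Minkowski.bilin)) + 𝓢.deviationExtend (⟨U, fun x ↦ Minkowski.bilin + ∑ i, (boostedKerrBilin (Λ i (x 0)) (E4.ofTimeSpace (x 0) (ξ i (x 0))) (M i) (a i) x - Minkowski.bilin), fun x ↦ x 0, E4.spatialNorm⟩ : ModelBackground) Φ x) (E4.ofTimeSpace s y) - Minkowski.bilin‖ ≤ 1 / 2 ∧
      ∀ v : E4, ‖fderiv ℝ (fun x : E4 ↦ (Minkowski.bilin + ∑ i, (boostedKerrBilin (Λ i (x 0)) (E4.ofTimeSpace (x 0) (ξ i (x 0))) (M i) (a i) x - Minkowski.bilin)) + 𝓢.deviationExtend (⟨U, fun x ↦ Minkowski.bilin + ∑ i, (boostedKerrBilin (Λ i (x 0)) (E4.ofTimeSpace (x 0) (ξ i (x 0))) (M i) (a i) x - Minkowski.bilin), fun x ↦ x 0, E4.spatialNorm⟩ : ModelBackground) Φ x) (E4.ofTimeSpace s y) v‖ ≤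
        K * ((⨅ i, ‖y - ξ i s‖) ^ (7 / 4 : ℝ))⁻¹ * ‖v‖ := by
  -- names for the background, the reference data and the deviation
  set G : E4 → E4 →L[ℝ] E4 →L[ℝ] ℝ := fun x ↦ Minkowski.bilin + ∑ i, (boostedKerrBilin (Λ i (x 0)) (E4.ofTimeSpace (x 0) (ξ i (x 0))) (M i) (a i) x - Minkowski.bilin) with hGdef
  set B : ModelBackground := ⟨U, G, fun x ↦ x 0, E4.spatialNorm⟩ with hBdef
  set h : E4 → E4 →L[ℝ] E4 →L[ℝ] ℝ := 𝓢.deviationExtend B Φ with hhdef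
  -- (0) uniform operator bound on the inverse frames, smoothness of the inverse frame paths
  set Γ : ℝ := max (1 + 3 * |γ|) 1 with hΓdef
  have hΓ1 : 1 ≤ Γ := le_max_right _ _
  have hΓ0 : 0 ≤ Γ := zero_le_one.trans hΓ1
  have hΛnorm : ∀ i t, ‖(((Λ i t : E4 ≃L[ℝ] E4).symm : E4 →L[ℝ] E4))‖ ≤ Γ := fun i t ↦ by
    refine (norm_lorentz_symm_le' (Λ i t)).trans (le_trans ?_ (le_max_left _ _))
    have := hγ i t
    have h2 : |((Λ i t : E4 ≃L[ℝ] E4) (E4.basisVector 0)) 0| ≤ |γ| := this.trans (le_abs_self γ)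
    linarith
  have hΛs : ∀ i, ContDiff ℝ ∞ (fun t ↦ (((Λ i t : E4 ≃L[ℝ] E4).symm : E4 →L[ℝ] E4))) := fun i ↦
    SublinearIsFree.QuasiStationarity.contDiff_lorentz_symm (hΛ i)
  -- (1) constants: order-zero size of the summands, spatial decay of `DG`
  obtain ⟨C₀, hC₀, hdec₀⟩ := exists_norm_iteratedFDeriv_ansatzSummand_le' 0 hΓ1
  obtain ⟨C₁, R₁, hC₁, hR₁, hdec₁⟩ := KSDecay.norm_fderiv_background_spatial_le M a
  set Mmax : ℝ := ∑ i, |M i| with hMmax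
  have hMi : ∀ i, |M i| ≤ Mmax := fun i ↦
    Finset.single_le_sum (f := fun i ↦ |M i|) (fun i _ ↦ abs_nonneg _) (Finset.mem_univ i)
  have hMmax0 : 0 ≤ Mmax := Finset.sum_nonneg fun i _ ↦ abs_nonneg _
  set Amax : ℝ := ∑ i, (|a i| + rin i) with hAmax
  have hAi : ∀ i, |a i| + rin i ≤ Amax := fun i ↦
    Finset.single_le_sum (f := fun i ↦ |a i| + rin i) (fun i _ ↦ by have := hrin i; positivity)
      (Finset.mem_univ i)
  have hAmax0 : 0 ≤ Amax := Finset.sum_nonneg fun i _ ↦ by have := hrin i; positivity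
  -- the threshold `L₀` the distance to the centres must exceed
  set L₀ : ℝ := 1 + R₁ + 2 * Amax + 4 * N * Mmax * C₀ with hL₀
  have hL₀1 : 1 ≤ L₀ := by
    have : 0 ≤ 4 * (N : ℝ) * Mmax * C₀ := by positivity
    linarith [hR₁.le]
  -- (2) eventual facts, merged into one time `T`
  have hev : ∀ᶠ t in atTop, L₀ ≤ ρq t ∧ τ₀ < t ∧
      (∀ x : E4, x 0 = t → E4.spatialNorm x ≤ κ * t → ρq t ≤ ⨅ i, ‖E4.spatial x - ξ i t‖ →
        (1 + √(√((⨅ i, ‖E4.spatial x - ξ i t‖) ^ 7))) * ‖fderiv ℝ G x (E4.basisVector 0)‖ ≤ 1) ∧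
      (∀ x : E4, x ∈ (U : Set E4) → x 0 = t → E4.spatialNorm x ≤ κ * t → ∀ m : ℕ, m ≤ 3 →
        (1 + √(√((⨅ i, ‖E4.spatial x - ξ i t‖) ^ 7))) * ‖iteratedFDeriv ℝ m h x‖ ≤ 1 / 4) := by
    have h1 : ∀ᶠ t in atTop, L₀ ≤ ρq t := (tendsto_atTop.1 hρq) L₀
    have h2 : ∀ᶠ t in atTop, τ₀ < t := eventually_gt_atTop τ₀
    have h3 := WindowBounds.quasiStationarity_pointwise (hQ ρq hρq) one_pos
    have h4 := WindowBounds.weightedClause_pointwise (U := U) (h := h) hWt (ε := 1 / 4) (by norm_num)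
    filter_upwards [h1, h2, h3, h4] with t ht1 ht2 ht3 ht4
    exact ⟨ht1, ht2, ht3, ht4⟩
  obtain ⟨T, hT⟩ := eventually_atTop.1 hev
  refine ⟨T, 2 + N * C₁ * Γ ^ 3, by positivity, ?_⟩
  intro s y hs hyκ hyρ
  obtain ⟨hL, hτ, hQs, hWs⟩ := hT s hs
  -- the point, its distances to the centres
  set x : E4 := E4.ofTimeSpace s y with hxdef
  have hx0 : x 0 = s := E4.ofTimeSpace_apply_zero s y
  have hxs : E4.spatial x = y := E4.spatial_ofTimeSpace s y
  have hxn : E4.spatialNorm x = ‖y‖ := E4.spatialNorm_ofTimeSpace s y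
  set d : ℝ := ⨅ i, ‖y - ξ i s‖ with hddef
  have hdL : L₀ ≤ d := hL.trans hyρ
  have hd1 : 1 ≤ d := hL₀1.trans hdL
  have hd0 : 0 < d := one_pos.trans_le hd1
  have hdi : ∀ i, d ≤ ‖y - ξ i s‖ := fun i ↦ WindowBounds.iInf_norm_sub_le (fun j ↦ ξ j s) i
  have hdist : ∀ i, L₀ ≤ ‖y - ξ i s‖ := fun i ↦ hdL.trans (hdi i)
  have hNNM : 0 ≤ 4 * (N : ℝ) * Mmax * C₀ := by positivity
  -- (3) membership in the chart domain
  have hxU : x ∈ (U : Set E4) := by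
    refine KSDecay.mem_domain_of_far hU hrin (y := x) (by rw [hx0]; exact hτ) fun i ↦ ?_
    rw [hxs, hx0]
    have h1 := hdist i
    have h2 := hAi i
    have h3 := hrin i
    linarith [hR₁.le]
  -- (4) order zero: `‖G x − η‖ ≤ 1/4`
  have hGsub : G x - Minkowski.bilin = ∑ i, (boostedKerrBilin (Λ i (x 0))
      (E4.ofTimeSpace (x 0) (ξ i (x 0))) (M i) (a i) x - Minkowski.bilin) := by
    simp only [hGdef]
    exact add_sub_cancel_left _ _
  have hsummand : ∀ i, ‖boostedKerrBilin (Λ i (x 0)) (E4.ofTimeSpace (x 0) (ξ i (x 0))) (M i) (a i) x -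
      Minkowski.bilin‖ ≤ |M i| * C₀ / ‖y - ξ i s‖ := by
    intro i
    have hfar : max 1 (2 * |a i|) ≤ ‖E4.spatial x - ξ i s‖ := by
      rw [hxs]
      refine max_le ((hL₀1).trans (hdist i)) ?_
      have h1 := hdist i
      have h2 := hAi i
      have h3 := hrin i
      linarith [hR₁.le]
    have key := hdec₀ (M i) (a i) (Λ i) (ξ i) s x ((hΛs i).of_le (by exact_mod_cast le_top))
      ((hξ i).of_le (by exact_mod_cast le_top))
      (fun k hk ↦ by
        have hk0 : k = 0 := Nat.le_zero.1 hk
        subst hk0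
        rw [iteratedDeriv_zero]
        exact hΛnorm i s)
      (fun k hk1 hk0 ↦ absurd (hk1.trans hk0) (by norm_num)) hx0 hfar
    rw [norm_iteratedFDeriv_zero, hxs] at key
    exact key
  have hGη : ‖G x - Minkowski.bilin‖ ≤ 1 / 4 := by
    rw [hGsub]
    refine (norm_sum_le _ _).trans ?_
    calc ∑ i, ‖boostedKerrBilin (Λ i (x 0)) (E4.ofTimeSpace (x 0) (ξ i (x 0))) (M i) (a i) x -
          Minkowski.bilin‖
        ≤ ∑ _i : Fin N, Mmax * C₀ / d := Finset.sum_le_sum fun i _ ↦ (hsummand i).trans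
            (div_le_div₀ (by positivity) (mul_le_mul_of_nonneg_right (hMi i) hC₀) hd0 (hdi i))
      _ = N * (Mmax * C₀ / d) := by simp [Finset.sum_const]
      _ ≤ 1 / 4 := by
          rw [← mul_div_assoc, div_le_iff₀ hd0]
          have : 4 * (N : ℝ) * Mmax * C₀ ≤ d := by linarith [hR₁.le]
          linarith
  -- (5) the deviation and its first derivative from the weighted clause
  have hWx := hWs x hxU hx0 (by rw [hxn]; exact hyκ)
  have hh0 : ‖h x‖ ≤ 1 / 4 := by
    have h1 := hWx 0 (by norm_num)
    rw [norm_iteratedFDeriv_zero] at h1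
    have hw : 1 ≤ 1 + √(√((⨅ i, ‖E4.spatial x - ξ i s‖) ^ 7)) :=
      le_add_of_nonneg_right (Real.sqrt_nonneg _)
    nlinarith [norm_nonneg (h x)]
  have hh1 : ‖fderiv ℝ h x‖ ≤ 1 / 4 * (d ^ (7 / 4 : ℝ))⁻¹ := by
    have h1 := hWx 1 (by norm_num)
    rw [norm_iteratedFDeriv_one, hxs] at h1
    exact WindowBounds.le_mul_rpow_inv_of_weighted hd0 le_rfl (norm_nonneg _) h1
  -- (6) `lab − η`
  have hlabη : ‖(G x + h x) - Minkowski.bilin‖ ≤ 1 / 2 := by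
    have : (G x + h x) - Minkowski.bilin = (G x - Minkowski.bilin) + h x := by abel
    rw [this]
    exact (norm_add_le _ _).trans (by linarith)
  -- (7) differentiability of `G`, `lab`, `h` at `x`
  have hrad : ∀ i, R₁ ≤ Kerr.radius (a i) (poincareInv (Λ i (x 0)) (E4.ofTimeSpace (x 0) (ξ i (x 0))) x) := by
    intro i
    have hfar : R₁ + |a i| ≤ ‖E4.spatial x - ξ i s‖ := by
      rw [hxs]
      have h1 := hdist i
      have h2 := hAi i
      have h3 := hrin i
      linarith
    have := KSDecay.le_radius_poincareInv_of_far (Λ i s) (a i) (ξ i s) (y := x) hR₁.le hfar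
    rw [hx0] at this ⊢
    exact this
  have hGd : DifferentiableAt ℝ G x := by
    have hsum : G = fun z : E4 ↦ Minkowski.bilin + (∑ i, fun z : E4 ↦ boostedKerrBilin (Λ i (z 0))
        (E4.ofTimeSpace (z 0) (ξ i (z 0))) (M i) (a i) z - Minkowski.bilin) z := by
      funext z
      simp only [hGdef, Finset.sum_apply]
    rw [hsum]
    refine (differentiableAt_const _).add (DifferentiableAt.sum fun i _ ↦ ?_)
    refine (contDiffAt_ansatzSummand (M := M i) (hΛs i) (hξ i) ?_).differentiableAt (by simp)
    exact hR₁.trans_le (hrad i)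
  have hlabd : DifferentiableAt ℝ (fun z ↦ B.bilin z + 𝓢.deviationExtend B Φ z) x :=
    ((LabMetric.contDiffOn_bilin_add_deviationExtend 𝓢 B hΦ).contDiffAt (U.2.mem_nhds hxU)).differentiableAt
      (by simp)
  have hhd : DifferentiableAt ℝ h x := by
    have : h = fun z ↦ (B.bilin z + 𝓢.deviationExtend B Φ z) - G z :=
      funext fun z ↦ (add_sub_cancel_left (G z) (h z)).symm
    rw [this]
    exact hlabd.sub hGd
  -- (8) first derivatives: lab time (quasi-stationarity), spatial (frozen decay), deviation (weighted clause)
  have hq0 : 0 < (d ^ (7 / 4 : ℝ))⁻¹ := inv_pos.2 (Real.rpow_pos_of_pos hd0 _)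
  have hDG0 : ‖fderiv ℝ G x (E4.basisVector 0)‖ ≤ (d ^ (7 / 4 : ℝ))⁻¹ := by
    have h1 := hQs x hx0 (by rw [hxn]; exact hyκ) (by rw [hxs]; exact hyρ)
    rw [hxs] at h1
    have h2 := WindowBounds.le_mul_rpow_inv_of_weighted hd0 le_rfl (norm_nonneg _) h1
    rwa [one_mul] at h2
  have hDGsp : ∀ w : E4, w 0 = 0 → ‖fderiv ℝ G x w‖ ≤ (N * C₁ * Γ ^ 3 * (d ^ (7 / 4 : ℝ))⁻¹) * ‖w‖ := by
    intro w hw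
    have key := hdec₁ Λ ξ (fun i ↦ (hΛs i).of_le (by exact_mod_cast le_top))
      (fun i ↦ (hξ i).of_le (by exact_mod_cast le_top)) x w hw
      (fun i ↦ by
        rw [hxs, hx0]
        have h1 := hdist i
        linarith [hAmax0])
    refine key.trans (mul_le_mul_of_nonneg_right ?_ (norm_nonneg _))
    rw [hxs, hx0]
    have hpow : d ^ (7 / 4 : ℝ) ≤ d ^ 2 := by
      have := Real.rpow_le_rpow_of_exponent_le hd1 (show (7 / 4 : ℝ) ≤ 2 by norm_num)
      rwa [Real.rpow_two] at this
    have hinv : (d ^ 2)⁻¹ ≤ (d ^ (7 / 4 : ℝ))⁻¹ := inv_anti₀ (Real.rpow_pos_of_pos hd0 _) hpow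
    calc ∑ i, C₁ * ‖(((Λ i s : E4 ≃L[ℝ] E4).symm : E4 →L[ℝ] E4))‖ ^ 3 / ‖y - ξ i s‖ ^ 2
        ≤ ∑ _i : Fin N, C₁ * Γ ^ 3 / d ^ 2 := Finset.sum_le_sum fun i _ ↦ by
            refine div_le_div₀ (by positivity) ?_ (by positivity) (pow_le_pow_left₀ hd0.le (hdi i) 2)
            exact mul_le_mul_of_nonneg_left (pow_le_pow_left₀ (norm_nonneg _) (hΛnorm i s) 3) hC₁
      _ = N * (C₁ * Γ ^ 3 / d ^ 2) := by simp [Finset.sum_const]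
      _ = N * C₁ * Γ ^ 3 * (d ^ 2)⁻¹ := by ring
      _ ≤ N * C₁ * Γ ^ 3 * (d ^ (7 / 4 : ℝ))⁻¹ := by gcongr
  have hDh : ‖fderiv ℝ h x‖ ≤ (d ^ (7 / 4 : ℝ))⁻¹ := hh1.trans (by nlinarith)
  -- (9) assemble
  have hK := WindowBounds.norm_fderiv_add_apply_le (G := G) (h := h) hGd hhd hDG0 hDGsp hDh
    (by positivity)
  refine ⟨⟨hxU, ?_⟩, ?_, fun v ↦ ?_⟩
  · change ‖(G x + h x) - Minkowski.bilin‖ < 1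
    linarith
  · change ‖(G x + h x) - Minkowski.bilin‖ ≤ 1 / 2
    exact hlabη
  · change ‖fderiv ℝ (fun z ↦ G z + h z) x v‖ ≤
      (2 + N * C₁ * Γ ^ 3) * ((⨅ i, ‖y - ξ i s‖) ^ (7 / 4 : ℝ))⁻¹ * ‖v‖
    refine (hK v).trans (le_of_eq ?_)
    ring

end ChargeModel

-- the algebraic and the operator-norm instance paths on `E4 →L[ℝ] E4 →L[ℝ] ℝ` unify slowly
set_option synthInstance.maxHeartbeats 400000 in
set_option maxHeartbeats 800000 in
/-- Registered sub-goal form (stub `lab_sphereConditions` of the crux item) of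
`ChargeModel.sphereConditions`: uniform far-field control of the lab metric of the crux's lab chart
(membership in the good region, `‖lab − η‖ ≤ 1/2`, `‖D lab‖ ≤ K d^{-7/4}`) — the sphere conditions of the
window law. [folklore] -/
theorem lab_sphereConditions : open Literature.Geometry.Lorentzian Filter in ∀ (𝓢 : Spacetime 4) {N : ℕ} (M a rin : Fin N → ℝ) (Λ : Fin N → ℝ → lorentzGroup) (ξ : Fin N → ℝ → E3) (γ κ τ₀ : ℝ) (U : Opens E4) (Φ : U → 𝓢.carrier) (hrin : ∀ i, 0 ≤ rin i) (hγ : ∀ i t, |((Λ i t : E4 ≃L[ℝ] E4) (E4.basisVector 0)) 0| ≤ γ) (hΛ : ∀ i, ContDiff ℝ ((⊤ : ℕ∞) : WithTop ℕ∞) (fun t ↦ ((Λ i t : E4 ≃L[ℝ] E4) : E4 →L[ℝ] E4))) (hξ : ∀ i, ContDiff ℝ ((⊤ : ℕ∞) : WithTop ℕ∞) (ξ i)) (hU : {x : E4 | τ₀ < x 0 ∧ ∀ i, rin i < Kerr.radius (a i) (poincareInv (Λ i (x 0)) (E4.ofTimeSpace (x 0) (ξ i (x 0))) x)} ⊆ (U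 : Set E4)) (hΦ : ContMDiff 𝓘(ℝ, E4) (𝓡 4) ((⊤ : ℕ∞) : WithTop ℕ∞) Φ) (hWt : Tendsto (fun t : ℝ ↦ ⨆ x ∈ {x : U | x.1 0 = t ∧ E4.spatialNorm x.1 ≤ κ * t}, ⨆ (m : ℕ) (_ : m ≤ 3), ENNReal.ofReal (1 + √(√((⨅ i, ‖E4.spatial x.1 - ξ i t‖) ^ 7))) * ‖iteratedFDeriv ℝ m (𝓢.deviationExtend (⟨U, fun x ↦ Minkowski.bilin + ∑ i, (boostedKerrBilin (Λ i (x 0)) (E4.ofTimeSpace (x 0) (ξ i (x 0))) (M i) (a i) x - Minkowski.bilin), fun x ↦ x 0, E4.spatialNorm⟩ : ModelBackground) Φ) x.1‖ₑ) atTop (nhds 0)) (hQ : ∀ ρ : ℝ → ℝ, Tendsto ρ atTop atTop → Tendsto (fun t : ℝ ↦ ⨆ x ∈ {x : E4 | x 0 = t ∧ E4.spatialNorm x ≤ κ * t ∧ ρ t ≤ ⨅ i, ‖E4.spatial x - ξ i t‖}, ENNReal.ofReal (1 + √(√((⨅ i, ‖E4.spatial x - ξ i t‖) ^ 7))) * ‖fderiv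 ℝ (fun y : E4 ↦ Minkowski.bilin + ∑ i, (boostedKerrBilin (Λ i (y 0)) (E4.ofTimeSpace (y 0) (ξ i (y 0))) (M i) (a i) y - Minkowski.bilin)) x (E4.basisVector 0)‖ₑ) atTop (nhds 0)) (ρq : ℝ → ℝ) (hρq : Tendsto ρq atTop atTop), ∃ T K : ℝ, 0 ≤ K ∧ ∀ (s : ℝ) (y : E3), T ≤ s → ‖y‖ ≤ κ * s → ρq s ≤ ⨅ i, ‖y - ξ i s‖ → (E4.ofTimeSpace s y ∈ (U : Set E4) ∧ ‖(fun x : E4 ↦ (Minkowski.bilin + ∑ i, (boostedKerrBilin (Λ i (x 0)) (E4.ofTimeSpace (x 0) (ξ i (x 0))) (M i) (a i) x - Minkowski.bilin)) + 𝓢.deviationExtend (⟨U, fun x ↦ Minkowski.bilin + ∑ i, (boostedKerrBilin (Λ i (x 0)) (E4.ofTimeSpace (x 0) (ξ i (x 0))) (M i) (a i) x - Minkowski.bilin), fun x ↦ x 0, E4.spatialNorm⟩ : ModelBackground) Φ x) (E4.ofTimeSpace s y) - Minkowski.bilin‖ < 1) ∧ ‖(fun x : E4 ↦ (Minkowski.bilin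 + ∑ i, (boostedKerrBilin (Λ i (x 0)) (E4.ofTimeSpace (x 0) (ξ i (x 0))) (M i) (a i) x - Minkowski.bilin)) + 𝓢.deviationExtend (⟨U, fun x ↦ Minkowski.bilin + ∑ i, (boostedKerrBilin (Λ i (x 0)) (E4.ofTimeSpace (x 0) (ξ i (x 0))) (M i) (a i) x - Minkowski.bilin), fun x ↦ x 0, E4.spatialNorm⟩ : ModelBackground) Φ x) (E4.ofTimeSpace s y) - Minkowski.bilin‖ ≤ 1 / 2 ∧ ∀ v : E4, ‖fderiv ℝ (fun x : E4 ↦ (Minkowski.bilin + ∑ i, (boostedKerrBilin (Λ i (x 0)) (E4.ofTimeSpace (x 0) (ξ i (x 0))) (M i) (a i) x - Minkowski.bilin)) + 𝓢.deviationExtend (⟨U, fun x ↦ Minkowski.bilin + ∑ i, (boostedKerrBilin (Λ i (x 0)) (E4.ofTimeSpace (x 0) (ξ i (x 0))) (M i) (a i) x - Minkowski.bilin), fun x ↦ x 0, E4.spatialNorm⟩ : ModelBackground) Φ x) (E4.ofTimeSpace s y) v‖ ≤ K * ((⨅ i, ‖y - ξ i s‖) ^ (7 / 4 : ℝ))⁻¹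 * ‖v‖ :=
  ChargeModel.sphereConditions

end Summit.FinalStateConjecture.FinalStateConjecture.Theorems

end
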